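import Summits.QuantumFields.YangMills.Theorems.PencilRigidityWeakCouplingHypercubicLimitStubTraceHolder

/-!
# Stub `stub_traceCluster` for the crux `WeakCouplingHypercubicLimit` (line `Sketch`)

The **trace cluster bound** (card `trace-norm-cold-pressure`, first lemma `TraceClusterBound`,
general exponents).  On a finite-dimensional real inner product space let `T ≥ 0` have a unit fixed
vector `Ω` (`T Ω = Ω`) and contract at rate `r ∈ [0, 1]` on `Ω^⊥`.  With `P := |Ω⟩⟨Ω|` and
`R_m := Tᵐ − P` one has `R_m = (1 − P) Tᵐ (1 − P) ≥ 0`, `‖R_m‖ ≤ rᵐ`, `tr R_m = tr Tᵐ − 1 ≥ 0`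
(the *trace excess*).  Expanding `tr(Tᵃ A Tᵇ B) = tr((P + R_a) A (P + R_b) B)` into four terms and
using the trace Hölder inequality `|tr(S M)| ≤ tr(S) ‖M‖` (stub `stub_traceHolder`) and
`|⟨Ω, M Ω⟩| ≤ ‖M‖` gives, for `Z := tr Tᴺ = 1 + tr R_N ≥ 1`,

  `|tr(Tᵃ A Tᵇ B)/Z − (tr(Tᵖ A)/Z)(tr(Tᵠ B)/Z)| ≤ ‖A‖‖B‖ (rᵇ(1 + Xa) + rᵃ + XN + Xp + Xq + Xp·Xq)`

whenever `tr Tᵃ − 1 ≤ Xa`, `tr Tᴺ − 1 ≤ XN`, `tr Tᵖ − 1 ≤ Xp`, `tr Tᵠ − 1 ≤ Xq`.  With `T` the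
normalised transfer matrix of a lattice gauge theory on a spatial torus this bounds every connected
torus time-correlation by operator norms, the second eigenvalue `r` and the trace excesses (thermal
multiplicities) alone (Osterwalder–Seiler 1978 §§2–3 for the transfer-matrix formalism; the inequality
itself is finite-dimensional linear algebra, `[folklore]`).
-/

noncomputable section

open scoped BigOperators InnerProductSpace
open InnerProductSpace

namespace Summit.QuantumFields.YangMills.Theorems.WeakCouplingHypercubicLimit.TraceNormColdPressure

section Operator

variable {E : Type*} [NormedAddCommGroup E] [InnerProductSpace ℝ E]

/-- `T ∘ |Ω⟩⟨Ω| = |Ω⟩⟨Ω|` when `T Ω = Ω`. [folklore] -/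
private theorem mul_rankOne_of_apply_eq (T : E →L[ℝ] E) {Ω : E} (hTΩ : T Ω = Ω) :
    T * rankOne ℝ Ω Ω = rankOne ℝ Ω Ω := by
  rw [ContinuousLinearMap.mul_def, comp_rankOne, hTΩ]

/-- `|Ω⟩⟨Ω| ∘ T = |Ω⟩⟨Ω|` when `T` is symmetric and `T Ω = Ω`. [folklore] -/
private theorem rankOne_mul_of_apply_eq {T : E →L[ℝ] E} (hT : T.IsPositive) {Ω : E}
    (hTΩ : T Ω = Ω) : rankOne ℝ Ω Ω * T = rankOne ℝ Ω Ω := by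
  ext v
  rw [ContinuousLinearMap.mul_def, ContinuousLinearMap.comp_apply, rankOne_apply, rankOne_apply,
    ← hT.inner_left_eq_inner_right, hTΩ]

/-- Powers: `Tᵐ ∘ |Ω⟩⟨Ω| = |Ω⟩⟨Ω|`. [folklore] -/
private theorem pow_mul_rankOne (T : E →L[ℝ] E) {Ω : E} (hTΩ : T Ω = Ω) (m : ℕ) :
    T ^ m * rankOne ℝ Ω Ω = rankOne ℝ Ω Ω := by
  induction m with
  | zero => rw [pow_zero, one_mul]
  | succ m ih => rw [pow_succ, mul_assoc, mul_rankOne_of_apply_eq T hTΩ, ih]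

/-- Powers: `|Ω⟩⟨Ω| ∘ Tᵐ = |Ω⟩⟨Ω|`. [folklore] -/
private theorem rankOne_mul_pow {T : E →L[ℝ] E} (hT : T.IsPositive) {Ω : E} (hTΩ : T Ω = Ω)
    (m : ℕ) : rankOne ℝ Ω Ω * T ^ m = rankOne ℝ Ω Ω := by
  induction m with
  | zero => rw [pow_zero, mul_one]
  | succ m ih => rw [pow_succ', ← mul_assoc, rankOne_mul_of_apply_eq hT hTΩ, ih]

/-- The decomposition `Tᵐ − P = (1 − P) Tᵐ (1 − P)` for `P = |Ω⟩⟨Ω|`, `‖Ω‖ = 1`, `T Ω = Ω`. [folklore] -/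
private theorem pow_sub_rankOne_eq {T : E →L[ℝ] E} (hT : T.IsPositive) {Ω : E} (hΩ : ‖Ω‖ = 1)
    (hTΩ : T Ω = Ω) (m : ℕ) :
    T ^ m - rankOne ℝ Ω Ω = (1 - rankOne ℝ Ω Ω) * T ^ m * (1 - rankOne ℝ Ω Ω) := by
  have h1 := pow_mul_rankOne T hTΩ m
  have h2 := rankOne_mul_pow hT hTΩ m
  have h3 : rankOne ℝ Ω Ω * rankOne ℝ Ω Ω = rankOne ℝ Ω Ω :=
    isIdempotentElem_rankOne_self (𝕜 := ℝ) hΩ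
  rw [sub_mul, one_mul, h2, mul_sub, mul_one, sub_mul, h1, h3, sub_self, sub_zero]

/-- A symmetric `T` with `T Ω = Ω` maps `Ω^⊥` into itself, and if it contracts there at rate
`r ≥ 0` then `Tᵐ` contracts there at rate `rᵐ`. [folklore] -/
private theorem pow_apply_perp {T : E →L[ℝ] E} (hT : T.IsPositive) {Ω : E} (hTΩ : T Ω = Ω)
    {r : ℝ} (hr : 0 ≤ r) (hcon : ∀ v, inner ℝ Ω v = 0 → ‖T v‖ ≤ r * ‖v‖) (m : ℕ) :
    ∀ w, inner ℝ Ω w = 0 → inner ℝ Ω ((T ^ m) w) = 0 ∧ ‖(T ^ m) w‖ ≤ r ^ m * ‖w‖ := by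
  induction m with
  | zero => intro w hw; simp [hw]
  | succ m ih =>
    intro w hw
    obtain ⟨h1, h2⟩ := ih w hw
    refine ⟨?_, ?_⟩
    · rw [pow_succ', mul_apply_eq_comp, ← hT.inner_left_eq_inner_right, hTΩ, h1]
    · rw [pow_succ', mul_apply_eq_comp, pow_succ', mul_assoc]
      exact (hcon _ h1).trans (mul_le_mul_of_nonneg_left h2 hr)

/-- `‖v − ⟨Ω, v⟩Ω‖ ≤ ‖v‖` and `v − ⟨Ω, v⟩Ω ⊥ Ω` for a unit vector `Ω`. [folklore] -/
private theorem sub_rankOne_apply_perp {Ω : E} (hΩ : ‖Ω‖ = 1) (v : E) :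
    inner ℝ Ω (v - rankOne ℝ Ω Ω v) = 0 ∧ ‖v - rankOne ℝ Ω Ω v‖ ≤ ‖v‖ := by
  have hΩΩ : inner ℝ Ω Ω = 1 := by
    rw [real_inner_self_eq_norm_sq, hΩ, one_pow]
  refine ⟨?_, ?_⟩
  · rw [rankOne_apply, inner_sub_right, real_inner_smul_right, hΩΩ, mul_one, sub_self]
  · have hsq : ‖v - rankOne ℝ Ω Ω v‖ ^ 2 = ‖v‖ ^ 2 - (inner ℝ Ω v) ^ 2 := by
      rw [rankOne_apply, @norm_sub_sq_real, norm_smul, hΩ, mul_one, real_inner_smul_right,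
        real_inner_comm, Real.norm_eq_abs, sq_abs]
      ring
    have h0 : 0 ≤ ‖v‖ := norm_nonneg _
    nlinarith [sq_nonneg (inner ℝ Ω v), norm_nonneg (v - rankOne ℝ Ω Ω v)]

/-- The contraction `‖(Tᵐ − |Ω⟩⟨Ω|) v‖ ≤ rᵐ ‖v‖`. [folklore] -/
private theorem norm_pow_sub_rankOne_apply_le {T : E →L[ℝ] E} (hT : T.IsPositive) {Ω : E}
    (hΩ : ‖Ω‖ = 1) (hTΩ : T Ω = Ω) {r : ℝ} (hr : 0 ≤ r)
    (hcon : ∀ v, inner ℝ Ω v = 0 → ‖T v‖ ≤ r * ‖v‖) (m : ℕ) (v : E) :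
    ‖(T ^ m - rankOne ℝ Ω Ω) v‖ ≤ r ^ m * ‖v‖ := by
  have e : (T ^ m - rankOne ℝ Ω Ω) v = (T ^ m) (v - rankOne ℝ Ω Ω v) := by
    rw [sub_apply, map_sub]
    congr 1
    have := congrArg (fun f : E →L[ℝ] E => f v) (pow_mul_rankOne T hTΩ m)
    simpa [mul_apply_eq_comp] using this.symm
  obtain ⟨hw0, hw1⟩ := sub_rankOne_apply_perp hΩ v
  rw [e]
  exact ((pow_apply_perp hT hTΩ hr hcon m) _ hw0).2.trans
    (mul_le_mul_of_nonneg_left hw1 (pow_nonneg hr m))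

/-- Operator-norm form: `‖Tᵐ − |Ω⟩⟨Ω|‖ ≤ rᵐ`. [folklore] -/
private theorem opNorm_pow_sub_rankOne_le {T : E →L[ℝ] E} (hT : T.IsPositive) {Ω : E}
    (hΩ : ‖Ω‖ = 1) (hTΩ : T Ω = Ω) {r : ℝ} (hr : 0 ≤ r)
    (hcon : ∀ v, inner ℝ Ω v = 0 → ‖T v‖ ≤ r * ‖v‖) (m : ℕ) :
    ‖T ^ m - rankOne ℝ Ω Ω‖ ≤ r ^ m :=
  ContinuousLinearMap.opNorm_le_bound _ (pow_nonneg hr m)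
    (norm_pow_sub_rankOne_apply_le hT hΩ hTΩ hr hcon m)

/-- `|Ω⟩⟨Ω| M |Ω⟩⟨Ω| = ⟨Ω, M Ω⟩ |Ω⟩⟨Ω|`. [folklore] -/
private theorem rankOne_mul_mul_rankOne (M : E →L[ℝ] E) (Ω : E) :
    rankOne ℝ Ω Ω * M * rankOne ℝ Ω Ω = (inner ℝ Ω (M Ω)) • rankOne ℝ Ω Ω := by
  ext v
  simp only [ContinuousLinearMap.mul_def, ContinuousLinearMap.comp_apply, rankOne_apply, map_smul,
    smul_apply, smul_smul, mul_comm]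

/-- `|⟨Ω, M Ω⟩| ≤ ‖M‖` for a unit vector `Ω`. [folklore] -/
private theorem abs_inner_apply_le_opNorm (M : E →L[ℝ] E) {Ω : E} (hΩ : ‖Ω‖ = 1) :
    |inner ℝ Ω (M Ω)| ≤ ‖M‖ := by
  calc |inner ℝ Ω (M Ω)| ≤ ‖Ω‖ * ‖M Ω‖ := abs_real_inner_le_norm _ _
    _ ≤ ‖Ω‖ * (‖M‖ * ‖Ω‖) := by gcongr; exact M.le_opNorm Ω
    _ = ‖M‖ := by rw [hΩ]; ring

section Trace

variable [FiniteDimensional ℝ E]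

/-- `tr(M ∘ |Ω⟩⟨Ω|) = ⟨Ω, M Ω⟩`. [folklore] -/
private theorem trace_mul_rankOne (M : E →L[ℝ] E) (Ω : E) :
    LinearMap.trace ℝ E (↑(M * rankOne ℝ Ω Ω) : E →ₗ[ℝ] E) = inner ℝ Ω (M Ω) := by
  rw [ContinuousLinearMap.mul_def, comp_rankOne, trace_rankOne]

/-- `tr(|Ω⟩⟨Ω| ∘ M) = ⟨Ω, M Ω⟩`. [folklore] -/
private theorem trace_rankOne_mul (M : E →L[ℝ] E) (Ω : E) :
    LinearMap.trace ℝ E (↑(rankOne ℝ Ω Ω * M) : E →ₗ[ℝ] E) = inner ℝ Ω (M Ω) := by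
  rw [ContinuousLinearMap.toLinearMap_mul, LinearMap.trace_mul_comm,
    ← ContinuousLinearMap.toLinearMap_mul, trace_mul_rankOne]

/-- The trace excess: `tr(Tᵐ − |Ω⟩⟨Ω|) = tr Tᵐ − 1` for a unit vector `Ω`. [folklore] -/
private theorem trace_pow_sub_rankOne (T : E →L[ℝ] E) {Ω : E} (hΩ : ‖Ω‖ = 1) (m : ℕ) :
    LinearMap.trace ℝ E (↑(T ^ m - rankOne ℝ Ω Ω) : E →ₗ[ℝ] E) =
      LinearMap.trace ℝ E (↑(T ^ m) : E →ₗ[ℝ] E) - 1 := by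
  rw [ContinuousLinearMap.toLinearMap_sub, map_sub, trace_rankOne, real_inner_self_eq_norm_sq, hΩ,
    one_pow]

end Trace

variable [CompleteSpace E]

/-- Powers of a positive operator are positive. [folklore] -/
private theorem isPositive_pow {T : E →L[ℝ] E} (hT : T.IsPositive) (m : ℕ) :
    (T ^ m).IsPositive := by
  induction m using Nat.twoStepInduction with
  | zero => rw [pow_zero]; exact ContinuousLinearMap.isPositive_one
  | one => rwa [pow_one]
  | more m ih _ =>
    have h := ih.adjoint_conj T
    rw [hT.isSelfAdjoint.adjoint_eq] at h
    have e : T ^ (m + 2) = T ∘L (T ^ m) ∘L T := by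
      rw [pow_succ, pow_succ', ← ContinuousLinearMap.mul_def, ← ContinuousLinearMap.mul_def,
        mul_assoc]
    rwa [e]

/-- `Tᵐ − |Ω⟩⟨Ω|` is positive. [folklore] -/
private theorem isPositive_pow_sub_rankOne {T : E →L[ℝ] E} (hT : T.IsPositive) {Ω : E}
    (hΩ : ‖Ω‖ = 1) (hTΩ : T Ω = Ω) (m : ℕ) : (T ^ m - rankOne ℝ Ω Ω).IsPositive := by
  have hQ : IsSelfAdjoint (1 - rankOne ℝ Ω Ω : E →L[ℝ] E) :=
    (IsSelfAdjoint.one _).sub (isStarProjection_rankOne_self (𝕜 := ℝ) hΩ).isSelfAdjoint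
  have h := (isPositive_pow hT m).adjoint_conj (1 - rankOne ℝ Ω Ω)
  rw [hQ.adjoint_eq] at h
  rwa [pow_sub_rankOne_eq hT hΩ hTΩ m, ContinuousLinearMap.mul_def, ContinuousLinearMap.mul_def,
    ContinuousLinearMap.comp_assoc]

end Operator

section RealBookkeeping

/-- The scalar bookkeeping behind the trace cluster bound: with `Z = 1 + xN ≥ 1`,
`u = αβ + e₁ + e₂ + e₃`, `s_A = α + e_A`, `s_B = β + e_B` and the stated bounds on the pieces,
`|u/Z − (s_A/Z)(s_B/Z)| ≤ n_A n_B (r_b (1 + Xa) + r_a + XN + Xp + Xq + Xp Xq)`. [folklore] -/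
private theorem real_bookkeeping (α β e1 e2 e3 eA eB xa xN xp xq Xa XN Xp Xq nA nB ra rb : ℝ)
    (hnA : 0 ≤ nA) (hnB : 0 ≤ nB) (hra : 0 ≤ ra) (hrb : 0 ≤ rb)
    (hxa0 : 0 ≤ xa) (hxN0 : 0 ≤ xN) (hxp0 : 0 ≤ xp) (hxq0 : 0 ≤ xq)
    (hXa : xa ≤ Xa) (hXN : xN ≤ XN) (hXp : xp ≤ Xp) (hXq : xq ≤ Xq)
    (hα : |α| ≤ nA) (hβ : |β| ≤ nB) (he1 : |e1| ≤ nA * rb * nB) (he2 : |e2| ≤ nB * ra * nA)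
    (he3 : |e3| ≤ xa * (nA * rb * nB)) (heA : |eA| ≤ xp * nA) (heB : |eB| ≤ xq * nB) :
    |(α * β + e1 + e2 + e3) / (1 + xN) - (α + eA) / (1 + xN) * ((β + eB) / (1 + xN))| ≤
      nA * nB * (rb * (1 + Xa) + ra + XN + Xp + Xq + Xp * Xq) := by
  have hZ1 : (1 : ℝ) ≤ 1 + xN := by linarith
  have hZ0 : (0 : ℝ) < 1 + xN := by linarith
  have hZne : (1 + xN : ℝ) ≠ 0 := hZ0.ne'
  have key : (α * β + e1 + e2 + e3) / (1 + xN) - (α + eA) / (1 + xN) * ((β + eB) / (1 + xN)) =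
      (xN * (α * β) + (1 + xN) * (e1 + e2 + e3) - α * eB - β * eA - eA * eB) / (1 + xN) ^ 2 := by
    field_simp
    ring
  rw [key, abs_div, abs_of_pos (by positivity : (0 : ℝ) < (1 + xN) ^ 2), div_le_iff₀ (by positivity)]
  -- bounds on the five pieces of the numerator
  have hαβ : |α| * |β| ≤ nA * nB := mul_le_mul hα hβ (abs_nonneg _) hnA
  have h1 : |xN * (α * β)| ≤ xN * (nA * nB) := by
    rw [abs_mul, abs_of_nonneg hxN0, abs_mul]
    exact mul_le_mul_of_nonneg_left hαβ hxN0
  have h2 : |(1 + xN) * (e1 + e2 + e3)| ≤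
      (1 + xN) * (nA * rb * nB + nB * ra * nA + xa * (nA * rb * nB)) := by
    rw [abs_mul, abs_of_pos hZ0]
    refine mul_le_mul_of_nonneg_left ?_ hZ0.le
    exact ((abs_add_le _ _).trans (add_le_add (abs_add_le _ _) le_rfl)).trans
      (add_le_add (add_le_add he1 he2) he3)
  have h3 : |α * eB| ≤ nA * (xq * nB) := by
    rw [abs_mul]; exact mul_le_mul hα heB (abs_nonneg _) hnA
  have h4 : |β * eA| ≤ nB * (xp * nA) := by
    rw [abs_mul]; exact mul_le_mul hβ heA (abs_nonneg _) hnB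
  have h5 : |eA * eB| ≤ xp * nA * (xq * nB) := by
    rw [abs_mul]; exact mul_le_mul heA heB (abs_nonneg _) (by positivity)
  have hnum : |xN * (α * β) + (1 + xN) * (e1 + e2 + e3) - α * eB - β * eA - eA * eB| ≤
      xN * (nA * nB) + (1 + xN) * (nA * rb * nB + nB * ra * nA + xa * (nA * rb * nB)) +
        nA * (xq * nB) + nB * (xp * nA) + xp * nA * (xq * nB) := by
    calc |xN * (α * β) + (1 + xN) * (e1 + e2 + e3) - α * eB - β * eA - eA * eB|
        ≤ |xN * (α * β) + (1 + xN) * (e1 + e2 + e3) - α * eB - β * eA| + |eA * eB| :=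
          abs_sub _ _
      _ ≤ |xN * (α * β) + (1 + xN) * (e1 + e2 + e3) - α * eB| + |β * eA| + |eA * eB| := by
          gcongr; exact abs_sub _ _
      _ ≤ |xN * (α * β) + (1 + xN) * (e1 + e2 + e3)| + |α * eB| + |β * eA| + |eA * eB| := by
          gcongr; exact abs_sub _ _
      _ ≤ |xN * (α * β)| + |(1 + xN) * (e1 + e2 + e3)| + |α * eB| + |β * eA| + |eA * eB| := by
          gcongr; exact abs_add_le _ _
      _ ≤ _ := by linarith [h1, h2, h3, h4, h5]
  -- `Z ≥ 1` absorbs the prefactors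
  have hW1 : 0 ≤ xN * (nA * nB) + nA * (xq * nB) + nB * (xp * nA) + xp * nA * (xq * nB) := by
    positivity
  have hW2 : 0 ≤ nA * rb * nB + nB * ra * nA + xa * (nA * rb * nB) := by positivity
  have hmono : nA * nB * (rb * (1 + xa) + ra + xN + xp + xq + xp * xq) ≤
      nA * nB * (rb * (1 + Xa) + ra + XN + Xp + Xq + Xp * Xq) := by
    have hpq : xp * xq ≤ Xp * Xq := mul_le_mul hXp hXq hxq0 (hxp0.trans hXp)
    have hrx : rb * (1 + xa) ≤ rb * (1 + Xa) := mul_le_mul_of_nonneg_left (by linarith) hrb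
    exact mul_le_mul_of_nonneg_left (by linarith) (mul_nonneg hnA hnB)
  have hZ2 : (1 + xN : ℝ) ≤ (1 + xN) ^ 2 := by
    calc (1 + xN : ℝ) = (1 + xN) * 1 := (mul_one _).symm
      _ ≤ (1 + xN) * (1 + xN) := mul_le_mul_of_nonneg_left hZ1 hZ0.le
      _ = (1 + xN) ^ 2 := (sq _).symm
  have hZsq1 : (1 : ℝ) ≤ (1 + xN) ^ 2 := hZ1.trans hZ2
  calc |xN * (α * β) + (1 + xN) * (e1 + e2 + e3) - α * eB - β * eA - eA * eB|
      ≤ xN * (nA * nB) + (1 + xN) * (nA * rb * nB + nB * ra * nA + xa * (nA * rb * nB)) +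
        nA * (xq * nB) + nB * (xp * nA) + xp * nA * (xq * nB) := hnum
    _ = (xN * (nA * nB) + nA * (xq * nB) + nB * (xp * nA) + xp * nA * (xq * nB)) +
        (1 + xN) * (nA * rb * nB + nB * ra * nA + xa * (nA * rb * nB)) := by ring
    _ ≤ (1 + xN) ^ 2 * (xN * (nA * nB) + nA * (xq * nB) + nB * (xp * nA) + xp * nA * (xq * nB)) +
        (1 + xN) ^ 2 * (nA * rb * nB + nB * ra * nA + xa * (nA * rb * nB)) :=
        add_le_add (le_mul_of_one_le_left hW1 hZsq1) (mul_le_mul_of_nonneg_right hZ2 hW2)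
    _ = nA * nB * (rb * (1 + xa) + ra + xN + xp + xq + xp * xq) * (1 + xN) ^ 2 := by ring
    _ ≤ nA * nB * (rb * (1 + Xa) + ra + XN + Xp + Xq + Xp * Xq) * (1 + xN) ^ 2 :=
        mul_le_mul_of_nonneg_right hmono (by positivity)

end RealBookkeeping

section Main

/-- `stub_traceCluster` (S3) — **the trace cluster bound, general exponents** (the card's first lemma
`TraceClusterBound`, reshaped): `T ≥ 0` on `ℝᵈ`, `T Ω = Ω`, `‖Ω‖ = 1`, `‖T v‖ ≤ r‖v‖` on `Ω^⊥`
(`0 ≤ r ≤ 1`); if the trace excesses are bounded, `tr Tᵃ − 1 ≤ Xa`, `tr Tᴺ − 1 ≤ XN`, `tr Tᵖ − 1 ≤ Xp`,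
`tr Tᵠ − 1 ≤ Xq`, then with `Z := tr Tᴺ`,
`|tr(Tᵃ A Tᵇ B)/Z − (tr(Tᵖ A)/Z)(tr(Tᵠ B)/Z)| ≤ ‖A‖‖B‖ (rᵇ(1 + Xa) + rᵃ + XN + Xp + Xq + Xp · Xq)`.
Proof: `Tᵐ = P_Ω + R_m` with `R_m ≥ 0`, `‖R_m‖ ≤ rᵐ`, `tr R_m = tr Tᵐ − 1 ≥ 0`; expand the four terms,
`stub_traceHolder`, `|⟨Ω, M Ω⟩| ≤ ‖M‖`, `Z = 1 + (tr Tᴺ − 1) ≥ 1`.  The card's `TraceClusterBound`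
(`p = q = N = a + b`, constant `3 X N`) is the special case up to the term `X N²`.  With `T` the
normalised transfer matrix of Wilson's theory on a spatial torus (Osterwalder–Seiler 1978 §§2–3) it
bounds every connected torus time-correlation by `‖A‖∞‖B‖∞`, the gap and the trace excesses. [folklore] -/
theorem stub_traceCluster :
    ∀ (d : ℕ) (T A B : EuclideanSpace ℝ (Fin d) →L[ℝ] EuclideanSpace ℝ (Fin d)) (Ω : EuclideanSpace ℝ (Fin d)) (r Xa XN Xp Xq : ℝ)
      (a b p q N : ℕ),
      T.IsPositive → ‖Ω‖ = 1 → T Ω = Ω → 0 ≤ r → r ≤ 1 →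
      (∀ v, inner ℝ Ω v = 0 → ‖T v‖ ≤ r * ‖v‖) →
      LinearMap.trace ℝ _ (↑(T ^ a) : EuclideanSpace ℝ (Fin d) →ₗ[ℝ] EuclideanSpace ℝ (Fin d)) - 1 ≤ Xa →
      LinearMap.trace ℝ _ (↑(T ^ N) : EuclideanSpace ℝ (Fin d) →ₗ[ℝ] EuclideanSpace ℝ (Fin d)) - 1 ≤ XN →
      LinearMap.trace ℝ _ (↑(T ^ p) : EuclideanSpace ℝ (Fin d) →ₗ[ℝ] EuclideanSpace ℝ (Fin d)) - 1 ≤ Xp →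
      LinearMap.trace ℝ _ (↑(T ^ q) : EuclideanSpace ℝ (Fin d) →ₗ[ℝ] EuclideanSpace ℝ (Fin d)) - 1 ≤ Xq →
      |LinearMap.trace ℝ _ (↑(T ^ a * A * T ^ b * B) : EuclideanSpace ℝ (Fin d) →ₗ[ℝ] EuclideanSpace ℝ (Fin d)) / LinearMap.trace ℝ _ (↑(T ^ N) : EuclideanSpace ℝ (Fin d) →ₗ[ℝ] EuclideanSpace ℝ (Fin d)) -
          LinearMap.trace ℝ _ (↑(T ^ p * A) : EuclideanSpace ℝ (Fin d) →ₗ[ℝ] EuclideanSpace ℝ (Fin d)) / LinearMap.trace ℝ _ (↑(T ^ N) : EuclideanSpace ℝ (Fin d) →ₗ[ℝ] EuclideanSpace ℝ (Fin d)) *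
            (LinearMap.trace ℝ _ (↑(T ^ q * B) : EuclideanSpace ℝ (Fin d) →ₗ[ℝ] EuclideanSpace ℝ (Fin d)) / LinearMap.trace ℝ _ (↑(T ^ N) : EuclideanSpace ℝ (Fin d) →ₗ[ℝ] EuclideanSpace ℝ (Fin d)))| ≤
        ‖A‖ * ‖B‖ * (r ^ b * (1 + Xa) + r ^ a + XN + Xp + Xq + Xp * Xq) := by
  intro d T A B Ω r Xa XN Xp Xq a b p q N hT hΩ hTΩ hr0 _hr1 hcon hXa hXN hXp hXq
  -- notation: `P = |Ω⟩⟨Ω|`, `τ = tr`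
  set P : EuclideanSpace ℝ (Fin d) →L[ℝ] EuclideanSpace ℝ (Fin d) := rankOne ℝ Ω Ω with hPdef
  have hdec : ∀ m : ℕ, T ^ m = P + (T ^ m - P) := fun m => by abel
  set τ : (EuclideanSpace ℝ (Fin d) →L[ℝ] EuclideanSpace ℝ (Fin d)) → ℝ :=
    fun M => LinearMap.trace ℝ _ (↑M : EuclideanSpace ℝ (Fin d) →ₗ[ℝ] EuclideanSpace ℝ (Fin d)) with hτ
  have τ_add : ∀ M M', τ (M + M') = τ M + τ M' := fun M M' => by
    simp only [hτ, ContinuousLinearMap.toLinearMap_add, map_add]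
  have τ_smul : ∀ (c : ℝ) (M : EuclideanSpace ℝ (Fin d) →L[ℝ] EuclideanSpace ℝ (Fin d)),
      τ (c • M) = c * τ M := fun c M => by
    simp only [hτ]
    rw [ContinuousLinearMap.toLinearMap_smul, map_smul, smul_eq_mul]
  have τ_comm : ∀ M M' : EuclideanSpace ℝ (Fin d) →L[ℝ] EuclideanSpace ℝ (Fin d),
      τ (M * M') = τ (M' * M) := fun M M' => by
    simp only [hτ]
    rw [ContinuousLinearMap.toLinearMap_mul, LinearMap.trace_mul_comm,
      ← ContinuousLinearMap.toLinearMap_mul]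
  have τ_P_mul : ∀ M : EuclideanSpace ℝ (Fin d) →L[ℝ] EuclideanSpace ℝ (Fin d),
      τ (P * M) = inner ℝ Ω (M Ω) := fun M => trace_rankOne_mul M Ω
  -- positivity, trace excesses, norms of the remainders `Tᵐ − P`
  have hRpos : ∀ m : ℕ, (T ^ m - P).IsPositive := fun m => isPositive_pow_sub_rankOne hT hΩ hTΩ m
  have hx : ∀ m : ℕ, τ (T ^ m - P) = τ (T ^ m) - 1 := fun m => trace_pow_sub_rankOne T hΩ m
  have hx0 : ∀ m : ℕ, 0 ≤ τ (T ^ m - P) := fun m => (hRpos m).toLinearMap.trace_nonneg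
  have hRn : ∀ m : ℕ, ‖T ^ m - P‖ ≤ r ^ m := fun m => opNorm_pow_sub_rankOne_le hT hΩ hTΩ hr0 hcon m
  -- the pieces
  have hα : |inner ℝ Ω (A Ω)| ≤ ‖A‖ := abs_inner_apply_le_opNorm A hΩ
  have hβ : |inner ℝ Ω (B Ω)| ≤ ‖B‖ := abs_inner_apply_le_opNorm B hΩ
  have hARB : ‖A * (T ^ b - P) * B‖ ≤ ‖A‖ * r ^ b * ‖B‖ := by
    calc ‖A * (T ^ b - P) * B‖ ≤ ‖A * (T ^ b - P)‖ * ‖B‖ := norm_mul_le _ _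
      _ ≤ ‖A‖ * ‖T ^ b - P‖ * ‖B‖ := by gcongr; exact norm_mul_le _ _
      _ ≤ ‖A‖ * r ^ b * ‖B‖ := by gcongr; exact hRn b
  have hBRA : ‖B * (T ^ a - P) * A‖ ≤ ‖B‖ * r ^ a * ‖A‖ := by
    calc ‖B * (T ^ a - P) * A‖ ≤ ‖B * (T ^ a - P)‖ * ‖A‖ := norm_mul_le _ _
      _ ≤ ‖B‖ * ‖T ^ a - P‖ * ‖A‖ := by gcongr; exact norm_mul_le _ _
      _ ≤ ‖B‖ * r ^ a * ‖A‖ := by gcongr; exact hRn a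
  have he1 : |inner ℝ Ω ((A * (T ^ b - P) * B) Ω)| ≤ ‖A‖ * r ^ b * ‖B‖ :=
    (abs_inner_apply_le_opNorm _ hΩ).trans hARB
  have he2 : |inner ℝ Ω ((B * (T ^ a - P) * A) Ω)| ≤ ‖B‖ * r ^ a * ‖A‖ :=
    (abs_inner_apply_le_opNorm _ hΩ).trans hBRA
  have he3 : |τ ((T ^ a - P) * (A * (T ^ b - P) * B))| ≤ τ (T ^ a - P) * (‖A‖ * r ^ b * ‖B‖) :=
    (stub_traceHolder d _ _ (hRpos a)).trans (mul_le_mul_of_nonneg_left hARB (hx0 a))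
  have heA : |τ ((T ^ p - P) * A)| ≤ τ (T ^ p - P) * ‖A‖ := stub_traceHolder d _ _ (hRpos p)
  have heB : |τ ((T ^ q - P) * B)| ≤ τ (T ^ q - P) * ‖B‖ := stub_traceHolder d _ _ (hRpos q)
  -- the identities
  have hu : τ (T ^ a * A * T ^ b * B) = inner ℝ Ω (A Ω) * inner ℝ Ω (B Ω) +
      inner ℝ Ω ((A * (T ^ b - P) * B) Ω) + inner ℝ Ω ((B * (T ^ a - P) * A) Ω) +
      τ ((T ^ a - P) * (A * (T ^ b - P) * B)) := by
    have e : T ^ a * A * T ^ b * B = P * (A * P * B) + P * (A * (T ^ b - P) * B) +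
        (T ^ a - P) * A * (P * B) + (T ^ a - P) * (A * (T ^ b - P) * B) := by
      conv_lhs => rw [hdec a, hdec b]
      noncomm_ring
    have hPAPB : τ (P * (A * P * B)) = inner ℝ Ω (A Ω) * inner ℝ Ω (B Ω) := by
      rw [τ_P_mul, mul_apply_eq_comp, mul_apply_eq_comp]
      simp only [hPdef, rankOne_apply, map_smul, real_inner_smul_right]
      ring
    rw [e, τ_add, τ_add, τ_add, hPAPB, τ_P_mul, τ_comm ((T ^ a - P) * A) (P * B),
      mul_assoc P B, τ_P_mul, ← mul_assoc]
  have hsA : τ (T ^ p * A) = inner ℝ Ω (A Ω) + τ ((T ^ p - P) * A) := by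
    conv_lhs => rw [hdec p]
    rw [add_mul, τ_add, τ_P_mul]
  have hsB : τ (T ^ q * B) = inner ℝ Ω (B Ω) + τ ((T ^ q - P) * B) := by
    conv_lhs => rw [hdec q]
    rw [add_mul, τ_add, τ_P_mul]
  have hZ : τ (T ^ N) = 1 + τ (T ^ N - P) := by rw [hx N]; ring
  -- assemble
  change |τ (T ^ a * A * T ^ b * B) / τ (T ^ N) - τ (T ^ p * A) / τ (T ^ N) * (τ (T ^ q * B) / τ (T ^ N))|
    ≤ ‖A‖ * ‖B‖ * (r ^ b * (1 + Xa) + r ^ a + XN + Xp + Xq + Xp * Xq)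
  rw [hu, hsA, hsB, hZ]
  change τ (T ^ a) - 1 ≤ Xa at hXa
  change τ (T ^ N) - 1 ≤ XN at hXN
  change τ (T ^ p) - 1 ≤ Xp at hXp
  change τ (T ^ q) - 1 ≤ Xq at hXq
  rw [← hx] at hXa hXN hXp hXq
  exact real_bookkeeping _ _ _ _ _ _ _ _ _ _ _ Xa XN Xp Xq ‖A‖ ‖B‖ (r ^ a) (r ^ b)
    (norm_nonneg _) (norm_nonneg _) (pow_nonneg hr0 _) (pow_nonneg hr0 _)
    (hx0 a) (hx0 N) (hx0 p) (hx0 q) hXa hXN hXp hXq hα hβ he1 he2 he3 heA heB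

end Main

section PublicToolkit
variable {E : Type*} [NormedAddCommGroup E] [InnerProductSpace ℝ E]
/-- Public form: `|⟨Ω, M Ω⟩| ≤ ‖M‖` for a unit vector `Ω`. [folklore] -/
theorem abs_real_inner_apply_le_opNorm (M : E →L[ℝ] E) {Ω : E} (hΩ : ‖Ω‖ = 1) :
    |inner ℝ Ω (M Ω)| ≤ ‖M‖ := abs_inner_apply_le_opNorm M hΩ
/-- Public form, traces: `tr(|Ω⟩⟨Ω| ∘ M) = ⟨Ω, M Ω⟩`. [folklore] -/
theorem trace_rankOne_mul_eq [FiniteDimensional ℝ E] (M : E →L[ℝ] E) (Ω : E) :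
    LinearMap.trace ℝ E (↑(rankOne ℝ Ω Ω * M) : E →ₗ[ℝ] E) = inner ℝ Ω (M Ω) := trace_rankOne_mul M Ω
/-- Public form, trace excess: `tr(Tᵐ − |Ω⟩⟨Ω|) = tr Tᵐ − 1` for a unit vector `Ω`. [folklore] -/
theorem trace_pow_sub_rankOne_eq [FiniteDimensional ℝ E] (T : E →L[ℝ] E) {Ω : E} (hΩ : ‖Ω‖ = 1)
    (m : ℕ) : LinearMap.trace ℝ E (↑(T ^ m - rankOne ℝ Ω Ω) : E →ₗ[ℝ] E) =
      LinearMap.trace ℝ E (↑(T ^ m) : E →ₗ[ℝ] E) - 1 := trace_pow_sub_rankOne T hΩ m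
/-- Registered rider `toolkit_powSubRankOne`: on `ℝᵈ`, for `T ≥ 0` with unit fixed vector `Ω` contracting at
rate `r ≥ 0` on `Ω^⊥`, the remainder `Tᵐ − |Ω⟩⟨Ω|` is positive, has norm `≤ rᵐ`, and trace `tr Tᵐ − 1`. [folklore] -/
theorem toolkit_powSubRankOne :
    ∀ (d : ℕ) (T : EuclideanSpace ℝ (Fin d) →L[ℝ] EuclideanSpace ℝ (Fin d)) (Ω : EuclideanSpace ℝ (Fin d)) (r : ℝ) (m : ℕ), T.IsPositive → ‖Ω‖ = 1 → T Ω = Ω → 0 ≤ r → (∀ v, inner ℝ Ω v = 0 → ‖T v‖ ≤ r * ‖v‖) → (T ^ m - InnerProductSpace.rankOne ℝ Ω Ω).IsPositive ∧ ‖T ^ m - InnerProductSpace.rankOne ℝ Ω Ω‖ ≤ r ^ m ∧ LinearMap.trace ℝ _ (↑(T ^ m - InnerProductSpace.rankOne ℝ Ω Ω) : EuclideanSpace ℝ (Fin d) →ₗ[ℝ] EuclideanSpace ℝ (Fin d)) = LinearMap.trace ℝ _ (↑(T ^ m) : EuclideanSpace ℝ (Fin d) →ₗ[ℝ] EuclideanSpace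 ℝ (Fin d)) - 1 :=
  fun _ T _ _ m hT hΩ hTΩ hr hcon =>
    ⟨isPositive_pow_sub_rankOne hT hΩ hTΩ m, opNorm_pow_sub_rankOne_le hT hΩ hTΩ hr hcon m,
      trace_pow_sub_rankOne T hΩ m⟩
end PublicToolkit

end Summit.QuantumFields.YangMills.Theorems.WeakCouplingHypercubicLimit.TraceNormColdPressure

end
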